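import Literature.NumberTheory.Sieve.LinearEquationsInPrimesSharpGYCorrelation
import Literature.NumberTheory.Sieve.LinearEquationsInPrimesPseudorandom
import Literature.NumberTheory.Sieve.LinearEquationsInPrimesDecomposition
import HarnessLib

/-!
# Linear equations in primes: the Gowers-uniformity estimate (12.6) for the smooth piece `Λ♯`,
# PROVED — `GreenTao2010_sharpGoldstonYildirim_holds`

Trunk T-SIEVE (`Literature/NumberTheory/Sieve`). This file DISCHARGES the named fact
`Literature.NumberTheory.Sieve.GreenTao2010_sharpGoldstonYildirim`
(`LinearEquationsInPrimesDecomposition.lean`; B. Green, T. Tao, *Linear equations in primes*, Ann. of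
Math. 171 (2010), §12, display (12.6): for every level `s ≥ 1` there are an admissible cutoff `χ`
(`χ(x) = x` on `[0, ½]`, Lipschitz) and an exponent `γ > 0` such that, with `R = N^γ`,
`‖Λ♯_{b,W} − 1‖_{U^{s+1}[N]} = o(1)` uniformly in the `W`-trick range `w₀ ≤ w ≤ ½ log log N` and in
`b ∈ [W]` coprime to `W` — the tree predicate `GreenTao2010_sharpUniformAt s χ (N ↦ N^γ)` of
`LinearEquationsInPrimesSplitVonMangoldt.lean`), one of the five named inputs of the assembly
`GreenTao2010_gowersUniformity_of_malcev_of_GI_of_MN_of_sharp` of Thm. 7.2.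

The proof is the printed one (App. D, "The correlation estimate for `Λ♯`", p. 1834 of the journal
version; arXiv:math/0606088 App. D), for a general dimension `k = s + 1 ≥ 1` of the Gowers norm:

* P0 `exists_sharpCutoff` — a smooth cutoff `χ(x) = x·β(x)` (`β` a smooth bump, `= 1` on `[-½, ½]`,
  `= 0` off `(-1, 1)`): `χ(x) = x` near `0` (so `χ'(0) = 1`), Lipschitz, `supp χ ⊆ [-1, 1]`; hence
  `Λ♯ = Λ_χ = −Λ_{χ,R,1}` (`vonMangoldtSmooth_eq_neg_truncDivisorSum`, "Now observe that
  `Λ♯ = −Λ_{χ♯,R,1}`").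
* P1 the cube system: rows `L_ω = (1, 1_ω) ∈ ℤ^{k+1}`, `ω ⊆ [k]` (`SharpGY.cubeRow`), every sub-system
  `(L_ω)_{ω ∈ S}` is GOOD in the sense of Thm. D.3 (`SharpGY.goodSystem_cubeRows`: the entry `1` in
  column `0`; for `ω ≠ ω'` the columns `0` and `1 + a`, `a ∈ ω △ ω'`, give a unimodular minor — "the
  system of forms `(x, h) ↦ x + ω·h` has no two forms parallel"); the cube polytope
  `A_N = {v ∈ ℝ^{k+1} : 1 ≤ v₀ + ω·(v₁,…,v_k) ≤ N for all ω}` is convex, lies in `[-N, N]^{k+1}`, has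
  volume `≤ (2N)^{k+1}`, and its lattice points are exactly the Gowers cube parameters
  `gowersCubeParams k N` under `(x, h) ↦ (x, h₁, …, h_k)` (`sum_gowersCubeParams_eq_sum_polytope`).
* P2 `abs_subcubeSum_sub_vol_le` — Thm. D.3 with `a_i = 1` (the tree's PROVED
  `SharpGY.exists_wtrick_correlation_bound`) applied to each sub-system over `A_N`: the `(φ(W)/W)^t`
  of `Λ♯_{b,W}` cancels D.3's local factor `(W/φ(W))^t`, and `(−1)^t (−χ'(0))^t = 1`, so every
  sub-cube correlation sum is `vol(A_N)(1 + O(K·err)) + O(log^t R · R^{2t} (N + 2R^t)^k)`.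
* P3 `exists_uniform_constants` — the constants of D.3 maxed over the `2^k + 1` possible numbers of
  forms `t = |S| ≤ 2^k`.
* P4 `sum_gowersCubeTerm_sub_one_eq` — the Gowers product `∏_ω (Λ♯_{b,W}(x + ω·h) − 1)` expanded by
  inclusion–exclusion into the `2^{2^k}` signed sub-cube sums (`Finset.prod_add`), whose common main
  term `vol(A_N)` cancels: `∑_{S ⊆ {0,1}^k} (−1)^{2^k − |S|} = 0` (`sum_sign_powerset_univ`).
* P5 `sharpUniformAt_of_cutoff` — the parameter bookkeeping: `R = N^γ` with `γ = 2^{−(k+2)}` (so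
  `R^{2^{k+1}} = N^{1/2}`; the paper suggests `γ_s = 2^{−s}/10`, any `γ < 2^{−(k+1)}` works),
  `w₀ ≥ 2^{k+1}` (D.3 needs `w ≥ 2t`), the side condition
  `C₀(1 + log(w+1) + S₁(w)) ≤ log^{1/2} R` and `K((1 + S₁(w)) log^{−1/2} R + e^{4·2^t/w} − 1) = o(1)`
  from `w ≤ ½ log log N`, `S₁(w) ≤ w + 1`, the count `#cubes ≥ (N/(2(k+1)))^{k+1}`
  (`pow_le_card_gowersCubeParams`), and `‖f‖_{U^k[N]} = |avg|^{1/2^k}`.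

Everything is proved inline; no named facts are introduced (net debt `−1`). The `s = 2` birth
skeleton of the parity-ideate cell (planner p2, `r6/bc/SharpTwo_birth.lean`, 2026-08-27: cutoff,
expansion identity, minors of the cube rows, signed cancellation and the parameter asymptotics at
`γ = 1/40`) is the special case `k = 3` of P0–P5 and was the model for this file.

## References

* B. Green, T. Tao, *Linear equations in primes*, Ann. of Math. (2) 171 (2010), 1753–1850
  (arXiv:math/0606088): §12, (12.3)–(12.6); App. D, Thm. D.3 and "The correlation estimate for `Λ♯`"
  (p. 1834); App. B (B.11) (the Gowers norms `U^k[N]`). [GreenTao2010]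
-/

noncomputable section

open Finset MeasureTheory Filter Topology
open scoped BigOperators

namespace Literature.NumberTheory.Sieve

namespace SharpGY

/-! ## P0 — the sharp cutoff -/

/-- **An admissible sharp cutoff exists**: `χ(x) = x·β(x)` for a smooth bump `β` equal to `1` on
`[-½, ½]` and to `0` off `(-1, 1)`; then `χ(x) = x` on `[-½, ½]` (so `χ'(0) = 1`), `χ` is smooth,
Lipschitz, and vanishes for `|x| ≥ 1` ("`χ♯` is a smooth, compactly supported cutoff which equals
`x` near `0`"). [cite: GreenTao2010, §12 (choice of `χ♯` before (12.3)) and App. D, p. 1834] -/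
theorem exists_sharpCutoff :
    ∃ (χ : ℝ → ℝ) (Lχ : ℝ), (∀ x, 0 ≤ x → x ≤ 1 / 2 → χ x = x) ∧
      (∀ x y, |χ x - χ y| ≤ Lχ * |x - y|) ∧ 0 ≤ Lχ ∧ ContDiff ℝ (⊤ : ℕ∞) χ ∧
      (∀ x, 1 ≤ |x| → χ x = 0) ∧ deriv χ 0 = 1 := by
  let φ : ContDiffBump (0 : ℝ) := ⟨1 / 2, 1, by norm_num, by norm_num⟩
  let χ : ℝ → ℝ := fun x => x * φ x
  have hχs : ContDiff ℝ (⊤ : ℕ∞) χ := contDiff_id.mul φ.contDiff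
  have hsupp : ∀ x, 1 ≤ |x| → χ x = 0 := by
    intro x hx
    have h0 : φ x = 0 := φ.zero_of_le_dist (by simpa [Real.dist_eq] using hx)
    simp [χ, h0]
  have hcs : HasCompactSupport χ := by
    refine HasCompactSupport.intro (isCompact_Icc (a := (-1 : ℝ)) (b := 1)) fun x hx => hsupp x ?_
    rw [Set.mem_Icc, not_and_or, not_le, not_le] at hx
    rcases hx with hx | hx
    · rw [abs_of_neg (by linarith)]; linarith
    · rw [abs_of_pos (by linarith)]; linarith
  have hχ1 : ContDiff ℝ 1 χ := hχs.of_le (by exact_mod_cast le_top)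
  obtain ⟨C, hC⟩ := hχ1.lipschitzWith_of_hasCompactSupport hcs one_ne_zero
  have hnear : ∀ x, |x| ≤ 1 / 2 → χ x = x := by
    intro x hx
    have h1 : φ x = 1 := φ.one_of_mem_closedBall (by
      rw [Metric.mem_closedBall, Real.dist_eq, sub_zero]; exact hx)
    simp [χ, h1]
  refine ⟨χ, C, fun x hx0 hx1 => hnear x (by rw [abs_of_nonneg hx0]; exact hx1),
    fun x y => ?_, C.2, hχs, hsupp, ?_⟩
  · have := hC.dist_le_mul x y
    rwa [Real.dist_eq, Real.dist_eq] at this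
  · have hev : χ =ᶠ[𝓝 0] fun x => x := by
      have hball : Metric.ball (0 : ℝ) (1 / 2) ∈ 𝓝 (0 : ℝ) := Metric.ball_mem_nhds 0 (by norm_num)
      filter_upwards [hball] with x hx
      rw [Metric.mem_ball, Real.dist_eq, sub_zero] at hx
      exact hnear x hx.le
    rw [hev.deriv_eq, deriv_id'']

/-! ## P1 — the cube system, its sub-systems and the cube polytope -/

variable {k : ℕ}

/-- Row `L_ω = (1, 1_ω) ∈ ℤ^{k+1}` of the Gowers cube system: `ψ_ω(x, h) = x + ω·h = L_ω · (x, h)`.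
[cite: GreenTao2010, App. D, p. 1834 (the system `(x + ω·h)_{ω ∈ {0,1}^{s+1}}`)] -/
def cubeRow (ω : Finset (Fin k)) : Fin (k + 1) → ℤ :=
  Fin.cases 1 (fun j : Fin k => if j ∈ ω then 1 else 0)

/-- The sub-system of cube rows indexed by `S ⊆ {0,1}^k`, enumerated by `S.equivFin`.
[cite: GreenTao2010, App. D, p. 1834] -/
def cubeRows (S : Finset (Finset (Fin k))) : Fin S.card → Fin (k + 1) → ℤ :=
  fun i => cubeRow (S.equivFin.symm i).1

/-- Column `0` of every cube row is `1` (the coefficient of `x` in `x + ω·h`).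
[cite: GreenTao2010, App. D, p. 1834 (the cube system `(x + ω·h)_ω`)] -/
@[simp] theorem cubeRow_zero (ω : Finset (Fin k)) : cubeRow ω 0 = 1 := by
  simp [cubeRow]

/-- Column `1 + a` of the row `L_ω` is the indicator of `a ∈ ω` (the coefficient of `h_a` in
`x + ω·h`). [cite: GreenTao2010, App. D, p. 1834 (the cube system `(x + ω·h)_ω`)] -/
@[simp] theorem cubeRow_succ (ω : Finset (Fin k)) (a : Fin k) :
    cubeRow ω a.succ = if a ∈ ω then 1 else 0 := by
  simp [cubeRow]

/-- `L_ω · (x, h) = x + ω·h`, the cube vertex. [cite: GreenTao2010, App. B (B.11)] -/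
theorem sum_cubeRow_mul_cons (ω : Finset (Fin k)) (x : ℤ) (h : Fin k → ℤ) :
    ∑ j, cubeRow ω j * (Fin.cons x h : Fin (k + 1) → ℤ) j = cubeVertex x h ω := by
  rw [Fin.sum_univ_succ, cubeRow_zero, Fin.cons_zero, one_mul, cubeVertex]
  congr 1
  simp only [cubeRow_succ, Fin.cons_succ, ite_mul, one_mul, zero_mul]
  rw [Finset.sum_ite_mem, Finset.univ_inter]

/-- Two distinct cube rows have a unimodular `2 × 2` minor (columns `0` and `1 + a` with
`a ∈ ω △ ω'`): no two forms of the cube system are parallel.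
[cite: GreenTao2010, App. D, proof of Thm. D.3 (no exceptional primes) and p. 1834] -/
theorem cubeRow_minor {ω ω' : Finset (Fin k)} (hne : ω ≠ ω') : ∃ j₀ j₁ : Fin (k + 1),
    cubeRow ω j₀ * cubeRow ω' j₁ - cubeRow ω j₁ * cubeRow ω' j₀ = 1 ∨
      cubeRow ω j₀ * cubeRow ω' j₁ - cubeRow ω j₁ * cubeRow ω' j₀ = -1 := by
  classical
  have hex : ∃ a : Fin k, (a ∈ ω ∧ a ∉ ω') ∨ (a ∉ ω ∧ a ∈ ω') := by
    by_contra hcon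
    push Not at hcon
    apply hne
    ext a
    exact ⟨fun ha => (hcon a).1 ha, fun ha => by_contra fun hb => (hcon a).2 hb ha⟩
  obtain ⟨a, ha⟩ := hex
  refine ⟨0, a.succ, ?_⟩
  rw [cubeRow_zero, cubeRow_zero, cubeRow_succ, cubeRow_succ]
  rcases ha with ⟨h1, h2⟩ | ⟨h1, h2⟩
  · right; simp [h1, h2]
  · left; simp [h1, h2]

/-- **Every sub-system of the cube system is good** in the sense of Thm. D.3 (`SharpGY.GoodSystem`).
[cite: GreenTao2010, App. D, p. 1834] -/
theorem goodSystem_cubeRows (S : Finset (Finset (Fin k))) : GoodSystem (cubeRows S) := by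
  refine ⟨fun i => ⟨0, cubeRow_zero _⟩, fun i i' hii' => ?_⟩
  exact cubeRow_minor fun h => hii' (S.equivFin.symm.injective (Subtype.ext h))

/-- The cube polytope `A_N = {v ∈ [-N, N]^{k+1} : 1 ≤ v₀ + ∑_{j ∈ ω} v_{1+j} ≤ N for all ω ⊆ [k]}`
(the convex body over which the sub-cube correlation sums are lattice-point sums).
[cite: GreenTao2010, App. D, p. 1834 and App. B (B.11)] -/
def cubePolytope (k N : ℕ) : Set (Fin (k + 1) → ℝ) :=
  realBox (k + 1) N ∩
    {v | ∀ ω : Finset (Fin k), 1 ≤ v 0 + ∑ j ∈ ω, v j.succ ∧ v 0 + ∑ j ∈ ω, v j.succ ≤ N}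

/-- `A_N ⊆ [-N, N]^{k+1}` (Thm. D.3 is stated for convex bodies in `[-N,N]^d`).
[cite: GreenTao2010, App. D, Thm. D.3 (hypothesis `K ⊆ [-N,N]^d`) and p. 1834] -/
theorem cubePolytope_subset_realBox (k N : ℕ) : cubePolytope k N ⊆ realBox (k + 1) N :=
  Set.inter_subset_left

/-- `A_N` is convex (an intersection of a box with slabs of linear functionals), as Thm. D.3
requires. [cite: GreenTao2010, App. D, Thm. D.3 (hypothesis: `K` convex) and p. 1834] -/
theorem convex_cubePolytope (k N : ℕ) : Convex ℝ (cubePolytope k N) := by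
  refine (convex_Icc _ _).inter ?_
  intro u hu v hv a b ha hb hab ω
  have hlin : (a • u + b • v) 0 + ∑ j ∈ ω, (a • u + b • v) j.succ =
      a * (u 0 + ∑ j ∈ ω, u j.succ) + b * (v 0 + ∑ j ∈ ω, v j.succ) := by
    simp only [Pi.add_apply, Pi.smul_apply, smul_eq_mul, Finset.sum_add_distrib]
    rw [← Finset.mul_sum, ← Finset.mul_sum]
    ring
  rw [hlin]
  obtain ⟨hu1, hu2⟩ := hu ω
  obtain ⟨hv1, hv2⟩ := hv ω
  constructor <;> nlinarith

/-- `vol(A_N) ≤ (2N)^{k+1}` (the main term of Thm. D.3 over `A_N` is `O(N^d)`).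
[cite: GreenTao2010, App. D, Thm. D.3 and p. 1834] -/
theorem volume_cubePolytope_le (k N : ℕ) :
    (volume (cubePolytope k N)).toReal ≤ (2 * (N : ℝ)) ^ (k + 1) := by
  have hbox : (volume (realBox (k + 1) (N : ℝ))).toReal = (2 * (N : ℝ)) ^ (k + 1) := by
    unfold realBox
    rw [Real.volume_Icc_pi_toReal (fun _ => by simp)]
    simp only [sub_neg_eq_add, Finset.prod_const, Finset.card_univ, Fintype.card_fin]
    ring
  rw [← hbox]
  exact ENNReal.toReal_mono (by unfold realBox; exact measure_Icc_lt_top.ne)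
    (measure_mono (cubePolytope_subset_realBox k N))

open Classical in
/-- The lattice points of `A_N` are the Gowers cube parameters: membership transfer along
`(x, h) ↦ (x, h₁, …, h_k)`. [cite: GreenTao2010, App. B (B.11)] -/
theorem cons_mem_polytopePoints_iff {N : ℕ} (x : ℤ) (h : Fin k → ℤ) :
    (Fin.cons x h : Fin (k + 1) → ℤ) ∈
        (latticeBox (k + 1) N).filter (fun n => realPoint n ∈ cubePolytope k N) ↔
      (x, h) ∈ gowersCubeParams k N := by
  rw [mem_gowersCubeParams, Finset.mem_filter]
  have hvert : ∀ ω : Finset (Fin k),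
      realPoint (Fin.cons x h : Fin (k + 1) → ℤ) 0 +
          ∑ j ∈ ω, realPoint (Fin.cons x h : Fin (k + 1) → ℤ) j.succ = ((cubeVertex x h ω : ℤ) : ℝ) := by
    intro ω
    simp only [realPoint, Fin.cons_zero, Fin.cons_succ, cubeVertex]
    push_cast
    ring
  constructor
  · rintro ⟨-, -, hω⟩ ω
    have h1 := hω ω
    rw [hvert ω] at h1
    rw [Finset.mem_Icc]
    exact ⟨by exact_mod_cast h1.1, by exact_mod_cast h1.2⟩
  · intro hω
    have hx := hω ∅
    rw [cubeVertex_empty, Finset.mem_Icc] at hx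
    have hh : ∀ j, -(N : ℤ) ≤ h j ∧ h j ≤ N := by
      intro j
      have hj := hω {j}
      rw [cubeVertex_singleton, Finset.mem_Icc] at hj
      omega
    refine ⟨?_, ?_, fun ω => ?_⟩
    · unfold latticeBox
      rw [Fintype.mem_piFinset]
      intro j
      refine Fin.cases ?_ (fun i => ?_) j
      · rw [Fin.cons_zero, Finset.mem_Icc]; omega
      · rw [Fin.cons_succ, Finset.mem_Icc]; exact hh i
    · unfold realBox
      simp only [Set.mem_Icc, Pi.le_def]
      refine ⟨fun j => ?_, fun j => ?_⟩
      · refine Fin.cases ?_ (fun i => ?_) j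
        · simp only [realPoint, Fin.cons_zero]; exact_mod_cast (by omega : -(N : ℤ) ≤ x)
        · simp only [realPoint, Fin.cons_succ]; exact_mod_cast (hh i).1
      · refine Fin.cases ?_ (fun i => ?_) j
        · simp only [realPoint, Fin.cons_zero]; exact_mod_cast hx.2
        · simp only [realPoint, Fin.cons_succ]; exact_mod_cast (hh i).2
    · have h1 := hω ω
      rw [Finset.mem_Icc] at h1
      rw [hvert ω]
      exact ⟨by exact_mod_cast h1.1, by exact_mod_cast h1.2⟩

open Classical in
/-- **Re-indexing of the cube sums as lattice-point sums over `A_N`** along the bijection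
`(x, h) ↦ n = (x, h₁, …, h_k)` of `ℤ × ℤ^k` with `ℤ^{k+1}`. [cite: GreenTao2010, App. B (B.11) and App. D, p. 1834] -/
theorem sum_gowersCubeParams_eq_sum_polytope {N : ℕ} (f : (Fin (k + 1) → ℤ) → ℝ) :
    ∑ p ∈ gowersCubeParams k N, f (Fin.cons p.1 p.2) =
      ∑ n ∈ (latticeBox (k + 1) N).filter (fun n => realPoint n ∈ cubePolytope k N), f n := by
  refine Finset.sum_nbij' (fun p => Fin.cons p.1 p.2) (fun n => (n 0, Fin.tail n)) ?_ ?_ ?_ ?_ ?_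
  · intro p hp
    exact (cons_mem_polytopePoints_iff p.1 p.2).2 hp
  · intro n hn
    have h := (cons_mem_polytopePoints_iff (N := N) (n 0) (Fin.tail n)).1 (by rwa [Fin.cons_self_tail])
    exact h
  · intro p _
    simp
  · intro n _
    exact Fin.cons_self_tail n
  · intro p _
    rfl

/-! ## P2 — the sub-cube correlation sums and Theorem D.3 -/

/-- The sub-cube correlation sum `G(S) = ∑_{(x,h) : cube ⊆ [N]} ∏_{ω ∈ S} Λ_{χ; b,W}(x + ω·h)` of the
`W`-tricked smooth piece over the cube parameters, for a set `S ⊆ {0,1}^k` of vertices.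
[cite: GreenTao2010, App. D, p. 1834] -/
def subcubeSum (χ : ℝ → ℝ) (R : ℝ) (W b N : ℕ) (S : Finset (Finset (Fin k))) : ℝ :=
  ∑ p ∈ gowersCubeParams k N, ∏ ω ∈ S, vonMangoldtSmoothW χ R W b (cubeVertex p.1 p.2 ω).toNat

open Classical in
/-- Theorem D.3's correlation sum `∑_{n ∈ A_N ∩ ℤ^{k+1}} ∏_{i} Λ_{χ,R,1}(W(L_i·n) + b)` for the
sub-system `(L_ω)_{ω ∈ S}` over the cube polytope. [cite: GreenTao2010, App. D, Thm. D.3 and p. 1834] -/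
def d3Sum (χ : ℝ → ℝ) (R : ℝ) (W : ℕ) (b : ℤ) (N : ℕ) (S : Finset (Finset (Fin k))) : ℝ :=
  ∑ n ∈ (latticeBox (k + 1) N).filter (fun n => realPoint n ∈ cubePolytope k N),
    ∏ i, truncDivisorSum χ R 1 ((wtrickSys W (cubeRows S) b i).eval n)

/-- `Λ_{χ; b,W}(m) = −(φ(W)/W) Λ_{χ,R,1}(Wm + b)` for `m ≥ 0`, `b ≥ 1`, `R > 1` and a cutoff vanishing
on `[1, ∞)` ("Now observe that `Λ♯ = −Λ_{χ♯,R,1}`"). [cite: GreenTao2010, App. D, p. 1834] -/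
theorem vonMangoldtSmoothW_toNat_eq {χ : ℝ → ℝ} (hχ : ∀ x, 1 ≤ x → χ x = 0) {R : ℝ} (hR : 1 < R)
    (W : ℕ) {b : ℕ} (hb : 1 ≤ b) {m : ℤ} (hm : 0 ≤ m) :
    vonMangoldtSmoothW χ R W b m.toNat =
      -((Nat.totient W : ℝ) / W) * truncDivisorSum χ R 1 ((W : ℤ) * m + b) := by
  unfold vonMangoldtSmoothW
  have hne : W * m.toNat + b ≠ 0 := by omega
  rw [vonMangoldtSmooth_eq_neg_truncDivisorSum hχ hR hne]
  have hcast : ((W * m.toNat + b : ℕ) : ℤ) = (W : ℤ) * m + b := by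
    push_cast
    rw [Int.toNat_of_nonneg hm]
  rw [hcast]
  ring

/-- **The re-indexing identity**: `G(S) = (−φ(W)/W)^{|S|} · (D.3's sum for the sub-system S over A_N)`.
[cite: GreenTao2010, App. D, p. 1834] -/
theorem subcubeSum_eq {χ : ℝ → ℝ} (hχ : ∀ x, 1 ≤ x → χ x = 0) {R : ℝ} (hR : 1 < R) (W : ℕ) {b : ℕ}
    (hb : 1 ≤ b) (N : ℕ) (S : Finset (Finset (Fin k))) :
    subcubeSum χ R W b N S =
      (-((Nat.totient W : ℝ) / W)) ^ S.card * d3Sum χ R W (b : ℤ) N S := by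
  classical
  unfold subcubeSum d3Sum
  rw [← sum_gowersCubeParams_eq_sum_polytope, Finset.mul_sum]
  refine Finset.sum_congr rfl fun p hp => ?_
  rw [mem_gowersCubeParams] at hp
  -- each factor
  have hfac : ∀ ω ∈ S, vonMangoldtSmoothW χ R W b (cubeVertex p.1 p.2 ω).toNat =
      -((Nat.totient W : ℝ) / W) * truncDivisorSum χ R 1 ((W : ℤ) * cubeVertex p.1 p.2 ω + b) := by
    intro ω _
    have h1 := hp ω
    rw [Finset.mem_Icc] at h1
    exact vonMangoldtSmoothW_toNat_eq hχ hR W hb (by omega)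
  rw [Finset.prod_congr rfl hfac, Finset.prod_mul_distrib, Finset.prod_const]
  congr 1
  -- `∏_{ω ∈ S}` versus `∏_{i : Fin |S|}` through `S.equivFin`
  have heval : ∀ i : Fin S.card, (wtrickSys W (cubeRows S) (b : ℤ) i).eval (Fin.cons p.1 p.2) =
      (W : ℤ) * cubeVertex p.1 p.2 (S.equivFin.symm i).1 + b := by
    intro i
    rw [wtrickSys_eval, cubeRows, sum_cubeRow_mul_cons]
  simp_rw [heval]
  rw [← Finset.prod_coe_sort S]
  exact (Fintype.prod_equiv S.equivFin.symm
    (fun i => truncDivisorSum χ R 1 ((W : ℤ) * cubeVertex p.1 p.2 (S.equivFin.symm i).1 + b))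
    (fun a => truncDivisorSum χ R 1 ((W : ℤ) * cubeVertex p.1 p.2 a.1 + b)) fun _ => rfl).symm

/-- **Theorem D.3 for one sub-cube system, main term normalised**: if D.3's conclusion holds for
the sub-system `S` over `A_N` with main term `V` (hypothesis `hmain`, an instance of
`SharpGY.exists_wtrick_correlation_bound`, `V = vol(A_N)`) and `χ'(0) = 1`, then
`|G(S) − V| ≤ V·K·err + E₂`: the factor `(φ(W)/W)^{|S|}` of `Λ_{χ;b,W}` cancels the
local factor `(W/φ(W))^{|S|}`, `(−1)^{|S|}(−χ'(0))^{|S|} = 1`, and `(φ(W)/W)^{|S|} ≤ 1` in front of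
`E₂`. [cite: GreenTao2010, App. D, p. 1834 ("`∏_p β_p = (W/φ(W))^{|S|}(1 + O(1/w))`")] -/
theorem abs_subcubeSum_sub_vol_le {χ : ℝ → ℝ} (hχ : ∀ x, 1 ≤ x → χ x = 0) (hderiv : deriv χ 0 = 1)
    {R : ℝ} (hR : 1 < R) (W : ℕ) (hW : 0 < W) {b : ℕ} (hb : 1 ≤ b) (N : ℕ)
    (S : Finset (Finset (Fin k))) {V K err E₂ : ℝ} (hE₂ : 0 ≤ E₂)
    (hmain : |d3Sum χ R W (b : ℤ) N S -
        V * ((W : ℝ) / Nat.totient W) ^ S.card * (-(deriv χ 0)) ^ S.card| ≤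
      V * ((W : ℝ) / Nat.totient W) ^ S.card * K * err + E₂) :
    |subcubeSum χ R W b N S - V| ≤ V * K * err + E₂ := by
  have hWr : (0 : ℝ) < W := by exact_mod_cast hW
  have hφr : (0 : ℝ) < Nat.totient W := by exact_mod_cast Nat.totient_pos.2 hW
  set r : ℝ := (Nat.totient W : ℝ) / W with hr_def
  set r' : ℝ := (W : ℝ) / Nat.totient W with hr'_def
  have hr : 0 < r := div_pos hφr hWr
  have hr1 : r ≤ 1 := by
    rw [hr_def, div_le_one hWr]; exact_mod_cast Nat.totient_le W
  have hrr' : r * r' = 1 := by rw [hr_def, hr'_def]; field_simp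
  set t := S.card
  have hpow : (-r) ^ t * (r' ^ t * (-(1 : ℝ)) ^ t) = 1 := by
    rw [← mul_pow, ← mul_pow, show -r * (r' * -1) = r * r' by ring, hrr', one_pow]
  rw [hderiv] at hmain
  rw [subcubeSum_eq hχ hR W hb N S]
  have key : (-r) ^ t * d3Sum χ R W (b : ℤ) N S - V =
      (-r) ^ t * (d3Sum χ R W (b : ℤ) N S - V * r' ^ t * (-(1 : ℝ)) ^ t) := by
    calc (-r) ^ t * d3Sum χ R W (b : ℤ) N S - V
        = (-r) ^ t * d3Sum χ R W (b : ℤ) N S - V * ((-r) ^ t * (r' ^ t * (-(1 : ℝ)) ^ t)) := by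
          rw [hpow, mul_one]
      _ = _ := by ring
  have habs : |(-r) ^ t| = r ^ t := by rw [abs_pow, abs_neg, abs_of_pos hr]
  rw [key, abs_mul, habs]
  calc r ^ t * |d3Sum χ R W (b : ℤ) N S - V * r' ^ t * (-(1 : ℝ)) ^ t|
      ≤ r ^ t * (V * r' ^ t * K * err + E₂) := mul_le_mul_of_nonneg_left hmain (pow_nonneg hr.le _)
    _ = V * (r * r') ^ t * K * err + r ^ t * E₂ := by rw [mul_pow]; ring
    _ = V * K * err + r ^ t * E₂ := by rw [hrr', one_pow, mul_one]
    _ ≤ V * K * err + 1 * E₂ := by gcongr; exact pow_le_one₀ hr.le hr1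
    _ = V * K * err + E₂ := by rw [one_mul]

/-! ## P3 — Theorem D.3 for all sub-cube systems at once (constants maxed over `t ≤ 2^k`) -/

/-- The main-term defect of Thm. D.3 at `t` forms, `(1 + S₁(w)) log^{-1/2} R + (e^{4·2^t/w} − 1)`, is
non-negative and monotone in `t`. [cite: GreenTao2010, App. D, Thm. D.3 ((D.9) error term)] -/
theorem errM_nonneg_mono {w : ℕ} (hw : 1 ≤ w) (R : ℝ) {t T : ℕ} (ht : t ≤ T) :
    0 ≤ (1 + logSum w) / Real.sqrt (Real.log R) + (Real.exp (4 * 2 ^ t / w) - 1) ∧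
      (1 + logSum w) / Real.sqrt (Real.log R) + (Real.exp (4 * 2 ^ t / w) - 1) ≤
        (1 + logSum w) / Real.sqrt (Real.log R) + (Real.exp (4 * 2 ^ T / w) - 1) := by
  have hw0 : (0 : ℝ) < w := by exact_mod_cast hw
  have h1 : 0 ≤ (1 + logSum w) / Real.sqrt (Real.log R) :=
    div_nonneg (by linarith [logSum_nonneg w]) (Real.sqrt_nonneg _)
  have h2 : 0 ≤ Real.exp (4 * 2 ^ t / w) - 1 := by
    have : (0 : ℝ) ≤ 4 * 2 ^ t / w := by positivity
    linarith [Real.add_one_le_exp (4 * 2 ^ t / (w : ℝ))]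
  have h3 : Real.exp (4 * 2 ^ t / w) ≤ Real.exp (4 * 2 ^ T / w) := by
    apply Real.exp_le_exp.2
    gcongr
    norm_num
  exact ⟨by linarith, by linarith⟩

open Classical in
/-- **Theorem D.3 (`a_i = 1`, the tree's `SharpGY.exists_wtrick_correlation_bound`) for every
sub-system of the `W`-tricked cube system over the cube polytope, with constants uniform in the
sub-system** (`t = |S| ≤ 2^k` forms in `d = k + 1` variables; the constants of D.3 depend on `χ, t, d`
only and are maxed over `t`; the side condition `w ≥ 2t` becomes `w ≥ 2^{k+1}`).
[cite: GreenTao2010, App. D, Thm. D.3 and p. 1834] -/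
theorem exists_uniform_d3 {χ : ℝ → ℝ} (hs : ContDiff ℝ (⊤ : ℕ∞) χ)
    (hsupp : ∀ x, 1 ≤ |x| → χ x = 0) (k : ℕ) :
    ∃ K C C₀ : ℝ, 0 ≤ K ∧ 0 ≤ C ∧ 1 ≤ C₀ ∧
      ∀ (N : ℕ), 1 ≤ N → ∀ (w b : ℕ), Nat.Coprime b (primorial w) → 2 * 2 ^ k ≤ w →
      ∀ (R : ℝ), Real.exp 1 ≤ R →
        C₀ * (1 + Real.log (w + 1) + logSum w) ≤ Real.sqrt (Real.log R) →
      ∀ S : Finset (Finset (Fin k)),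
        |d3Sum χ R (primorial w) (b : ℤ) N S -
            (volume (cubePolytope k N)).toReal *
              ((primorial w : ℝ) / Nat.totient (primorial w)) ^ S.card * (-(deriv χ 0)) ^ S.card| ≤
          (volume (cubePolytope k N)).toReal *
              ((primorial w : ℝ) / Nat.totient (primorial w)) ^ S.card * K *
              ((1 + logSum w) / Real.sqrt (Real.log R) + (Real.exp (4 * 2 ^ (2 ^ k) / w) - 1)) +
            C * Real.log R ^ (2 ^ k) * R ^ (2 ^ k) * (R ^ (2 ^ k) * ((N : ℝ) + 2 * R ^ (2 ^ k)) ^ k) := by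
  have hd : 1 ≤ k + 1 := Nat.le_add_left 1 k
  choose K C C₀ hK hC hC₀ hD using
    fun t : ℕ => exists_wtrick_correlation_bound (d := k + 1) (t := t) hs hsupp hd
  set I : Finset ℕ := Finset.range (2 ^ k + 1) with hI
  have hmemI : ∀ {t : ℕ}, t ≤ 2 ^ k → t ∈ I := fun ht => by
    rw [hI, Finset.mem_range]; omega
  refine ⟨∑ t ∈ I, K t, ∑ t ∈ I, C t, ∑ t ∈ I, C₀ t, Finset.sum_nonneg fun t _ => hK t,
    Finset.sum_nonneg fun t _ => hC t, ?_, ?_⟩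
  · calc (1 : ℝ) ≤ C₀ 0 := hC₀ 0
      _ ≤ ∑ t ∈ I, C₀ t :=
          Finset.single_le_sum (fun t _ => (zero_le_one.trans (hC₀ t))) (hmemI (Nat.zero_le _))
  intro N hN w b hb hw R hR hside S
  set t : ℕ := S.card with ht_def
  have ht : t ≤ 2 ^ k := by
    have := Finset.card_le_univ S
    rwa [Fintype.card_finset, Fintype.card_fin] at this
  have hKt : K t ≤ ∑ t ∈ I, K t := Finset.single_le_sum (fun t _ => hK t) (hmemI ht)
  have hCt : C t ≤ ∑ t ∈ I, C t := Finset.single_le_sum (fun t _ => hC t) (hmemI ht)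
  have hC₀t : C₀ t ≤ ∑ t ∈ I, C₀ t :=
    Finset.single_le_sum (fun t _ => (zero_le_one.trans (hC₀ t))) (hmemI ht)
  -- hypotheses of D.3 at `t = |S|`
  have hw1 : 1 ≤ w := le_trans (by linarith [Nat.one_le_two_pow (n := k)] : 1 ≤ 2 * 2 ^ k) hw
  have hw0 : (0 : ℝ) < w := by exact_mod_cast hw1
  have h2t : 2 * t ≤ w := le_trans (Nat.mul_le_mul_left 2 ht) hw
  have hcop : IsCoprime (b : ℤ) (primorial w) := Nat.isCoprime_iff_coprime.mpr hb
  have hpos : 0 ≤ 1 + Real.log (w + 1) + logSum w := by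
    have : 0 ≤ Real.log (w + 1) := Real.log_nonneg (by linarith)
    linarith [logSum_nonneg w]
  have hside_t : C₀ t * (1 + Real.log (w + 1) + logSum w) ≤ Real.sqrt (Real.log R) :=
    (mul_le_mul_of_nonneg_right hC₀t hpos).trans hside
  have hmain := hD t N hN (cubePolytope k N) (convex_cubePolytope k N)
    (cubePolytope_subset_realBox k N) (cubeRows S) (goodSystem_cubeRows S) w (b : ℤ) hcop h2t hw1
    R hR hside_t
  -- monotonicity of the two error terms in `t`
  have hR1 : 1 ≤ R := le_trans (by linarith [Real.add_one_le_exp (1 : ℝ)]) hR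
  have hR0 : 0 ≤ R := zero_le_one.trans hR1
  have hlogR1 : 1 ≤ Real.log R := by
    rw [Real.le_log_iff_exp_le (by linarith)]; exact hR
  have hlogR0 : 0 ≤ Real.log R := zero_le_one.trans hlogR1
  have hV0 : 0 ≤ (volume (cubePolytope k N)).toReal := ENNReal.toReal_nonneg
  have hr'0 : 0 ≤ ((primorial w : ℝ) / Nat.totient (primorial w)) ^ t := by positivity
  have hKsum : 0 ≤ ∑ t ∈ I, K t := Finset.sum_nonneg fun t _ => hK t
  have hCsum : 0 ≤ ∑ t ∈ I, C t := Finset.sum_nonneg fun t _ => hC t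
  obtain ⟨herr0, herr_le⟩ := errM_nonneg_mono hw1 R (show t ≤ 2 ^ k from ht)
  have hMt0 : 0 ≤ (N : ℝ) + 2 * R ^ t := by positivity
  have hE : C t * Real.log R ^ t * R ^ t * (R ^ t * ((N : ℝ) + 2 * R ^ t) ^ (k + 1 - 1)) ≤
      (∑ t ∈ I, C t) * Real.log R ^ (2 ^ k) * R ^ (2 ^ k) *
        (R ^ (2 ^ k) * ((N : ℝ) + 2 * R ^ (2 ^ k)) ^ k) := by
    rw [Nat.add_sub_cancel]
    have h1 : Real.log R ^ t ≤ Real.log R ^ (2 ^ k) := pow_le_pow_right₀ hlogR1 ht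
    have h2 : R ^ t ≤ R ^ (2 ^ k) := pow_le_pow_right₀ hR1 ht
    have h3 : ((N : ℝ) + 2 * R ^ t) ^ k ≤ ((N : ℝ) + 2 * R ^ (2 ^ k)) ^ k :=
      pow_le_pow_left₀ hMt0 (by linarith) k
    have a1 : C t * Real.log R ^ t ≤ (∑ t ∈ I, C t) * Real.log R ^ (2 ^ k) :=
      mul_le_mul hCt h1 (pow_nonneg hlogR0 _) hCsum
    have a2 : C t * Real.log R ^ t * R ^ t ≤ (∑ t ∈ I, C t) * Real.log R ^ (2 ^ k) * R ^ (2 ^ k) :=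
      mul_le_mul a1 h2 (pow_nonneg hR0 _) (mul_nonneg hCsum (pow_nonneg hlogR0 _))
    have a3 : R ^ t * ((N : ℝ) + 2 * R ^ t) ^ k ≤ R ^ (2 ^ k) * ((N : ℝ) + 2 * R ^ (2 ^ k)) ^ k :=
      mul_le_mul h2 h3 (pow_nonneg hMt0 _) (pow_nonneg hR0 _)
    exact mul_le_mul a2 a3 (mul_nonneg (pow_nonneg hR0 _) (pow_nonneg hMt0 _))
      (mul_nonneg (mul_nonneg hCsum (pow_nonneg hlogR0 _)) (pow_nonneg hR0 _))
  have hM : (volume (cubePolytope k N)).toReal *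
        ((primorial w : ℝ) / Nat.totient (primorial w)) ^ t * K t *
        ((1 + logSum w) / Real.sqrt (Real.log R) + (Real.exp (4 * 2 ^ t / w) - 1)) ≤
      (volume (cubePolytope k N)).toReal *
        ((primorial w : ℝ) / Nat.totient (primorial w)) ^ t * (∑ t ∈ I, K t) *
        ((1 + logSum w) / Real.sqrt (Real.log R) + (Real.exp (4 * 2 ^ (2 ^ k) / w) - 1)) :=
    mul_le_mul (mul_le_mul_of_nonneg_left hKt (mul_nonneg hV0 hr'0)) herr_le herr0
      (mul_nonneg (mul_nonneg hV0 hr'0) hKsum)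
  unfold d3Sum
  exact hmain.trans (add_le_add hM hE)

/-! ## P4 — inclusion–exclusion of the Gowers product and the signed cancellation -/

/-- The Gowers cube product of the real function `F − 1` expands as
`∏_ω (F(x + ω·h) − 1) = ∑_{S ⊆ {0,1}^k} (−1)^{2^k − |S|} ∏_{ω ∈ S} F(x + ω·h)`.
[cite: GreenTao2010, App. D, p. 1834 ("expand out the Gowers norm")] -/
theorem gowersCubeTerm_sub_one_eq (F : ℤ → ℝ) (x : ℤ) (h : Fin k → ℤ) :
    gowersCubeTerm k (fun n => ((F n - 1 : ℝ) : ℂ)) x h =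
      ∑ S ∈ (Finset.univ : Finset (Finset (Fin k))).powerset,
        (-1 : ℂ) ^ (2 ^ k - S.card) * ∏ ω ∈ S, ((F (cubeVertex x h ω) : ℝ) : ℂ) := by
  classical
  unfold gowersCubeTerm
  simp only [conjPow_ofReal]
  have h1 : ∀ ω : Finset (Fin k), (((F (cubeVertex x h ω) - 1 : ℝ)) : ℂ) =
      ((F (cubeVertex x h ω) : ℝ) : ℂ) + (-1) := by
    intro ω; push_cast; ring
  simp_rw [h1]
  rw [Finset.prod_add]
  refine Finset.sum_congr rfl fun S _ => ?_
  rw [Finset.prod_const, Finset.card_univ_sdiff, Fintype.card_finset, Fintype.card_fin, mul_comm]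

/-- The sum over the cube parameters of the expanded Gowers product is the signed sum of the
`2^{2^k}` sub-cube correlation sums. [cite: GreenTao2010, App. D, p. 1834] -/
theorem sum_gowersCubeTerm_sub_one_eq (F : ℤ → ℝ) (N : ℕ) :
    ∑ p ∈ gowersCubeParams k N, gowersCubeTerm k (fun n => ((F n - 1 : ℝ) : ℂ)) p.1 p.2 =
      ((∑ S ∈ (Finset.univ : Finset (Finset (Fin k))).powerset, (-1 : ℝ) ^ (2 ^ k - S.card) *
          ∑ p ∈ gowersCubeParams k N, ∏ ω ∈ S, F (cubeVertex p.1 p.2 ω) : ℝ) : ℂ) := by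
  classical
  simp_rw [gowersCubeTerm_sub_one_eq]
  rw [Finset.sum_comm]
  push_cast
  refine Finset.sum_congr rfl fun S _ => ?_
  rw [Finset.mul_sum]

/-- **The signed main terms cancel**: `∑_{S ⊆ {0,1}^k} (−1)^{2^k − |S|} = (1 − 1)^{2^k} = 0`.
[cite: GreenTao2010, App. D, p. 1834] -/
theorem sum_sign_powerset_univ (k : ℕ) :
    ∑ S ∈ (Finset.univ : Finset (Finset (Fin k))).powerset, (-1 : ℝ) ^ (2 ^ k - S.card) = 0 := by
  classical
  have hc : (Finset.univ : Finset (Finset (Fin k))).card = 2 ^ k := by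
    rw [Finset.card_univ, Fintype.card_finset, Fintype.card_fin]
  have h := Finset.prod_add (fun _ : Finset (Fin k) => (1 : ℝ)) (fun _ => (-1 : ℝ)) Finset.univ
  have hl : ∏ i ∈ (Finset.univ : Finset (Finset (Fin k))),
      ((fun _ : Finset (Fin k) => (1 : ℝ)) i + (fun _ => (-1 : ℝ)) i) = 0 := by
    rw [Finset.prod_const, hc]
    norm_num
  rw [hl] at h
  rw [h]
  refine Finset.sum_congr rfl fun S _ => ?_
  rw [Finset.prod_const_one, one_mul, Finset.prod_const, Finset.card_univ_sdiff, Fintype.card_finset,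
    Fintype.card_fin]

/-- **Signed cancellation with a common main term**: if every sub-cube sum is within `B` of the
same `V`, the signed sum is at most `2^{2^k} B`. [cite: GreenTao2010, App. D, p. 1834] -/
theorem abs_signedSum_le {G : Finset (Finset (Fin k)) → ℝ} {V B : ℝ}
    (hG : ∀ S, |G S - V| ≤ B) :
    |∑ S ∈ (Finset.univ : Finset (Finset (Fin k))).powerset, (-1 : ℝ) ^ (2 ^ k - S.card) * G S| ≤
      2 ^ (2 ^ k) * B := by
  classical
  have hsplit : ∑ S ∈ (Finset.univ : Finset (Finset (Fin k))).powerset,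
      (-1 : ℝ) ^ (2 ^ k - S.card) * G S =
      ∑ S ∈ (Finset.univ : Finset (Finset (Fin k))).powerset,
        (-1 : ℝ) ^ (2 ^ k - S.card) * (G S - V) := by
    have e : ∑ S ∈ (Finset.univ : Finset (Finset (Fin k))).powerset,
        (-1 : ℝ) ^ (2 ^ k - S.card) * (G S - V) =
        ∑ S ∈ (Finset.univ : Finset (Finset (Fin k))).powerset, (-1 : ℝ) ^ (2 ^ k - S.card) * G S -
          V * ∑ S ∈ (Finset.univ : Finset (Finset (Fin k))).powerset,
            (-1 : ℝ) ^ (2 ^ k - S.card) := by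
      rw [Finset.mul_sum, ← Finset.sum_sub_distrib]
      exact Finset.sum_congr rfl fun S _ => by ring
    rw [e, sum_sign_powerset_univ, mul_zero, sub_zero]
  have hcard : ((Finset.univ : Finset (Finset (Fin k))).powerset.card : ℝ) = 2 ^ (2 ^ k) := by
    rw [Finset.card_powerset, Finset.card_univ, Fintype.card_finset, Fintype.card_fin]
    push_cast
    ring
  rw [hsplit]
  calc |∑ S ∈ (Finset.univ : Finset (Finset (Fin k))).powerset,
          (-1 : ℝ) ^ (2 ^ k - S.card) * (G S - V)|
      ≤ ∑ S ∈ (Finset.univ : Finset (Finset (Fin k))).powerset,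
          |(-1 : ℝ) ^ (2 ^ k - S.card) * (G S - V)| := Finset.abs_sum_le_sum_abs _ _
    _ ≤ ∑ S ∈ (Finset.univ : Finset (Finset (Fin k))).powerset, B :=
        Finset.sum_le_sum fun S _ => by
          rw [abs_mul, abs_pow, abs_neg, abs_one, one_pow, one_mul]
          exact hG S
    _ = 2 ^ (2 ^ k) * B := by rw [Finset.sum_const, nsmul_eq_mul, hcard]

/-! ## P5 — the parameter bookkeeping: (12.6) with `R = N^{1/2^{k+2}}` -/

/-- `(log y + 2)/√(c·y) → 0` as `y → ∞`, for `c > 0`. [folklore] -/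
private theorem tendsto_log_add_two_div_sqrt {c : ℝ} (hc : 0 < c) :
    Tendsto (fun y : ℝ => (Real.log y + 2) / Real.sqrt (c * y)) atTop (𝓝 0) := by
  have h1 : Tendsto (fun y : ℝ => Real.log y / y ^ (1 / 2 : ℝ)) atTop (𝓝 0) := by
    have := (isLittleO_log_rpow_rpow_atTop (s := 1 / 2) 1 (by norm_num)).tendsto_div_nhds_zero
    refine this.congr' ?_
    filter_upwards [eventually_ge_atTop (0 : ℝ)] with y hy
    simp [Real.rpow_one]
  have h2 : Tendsto (fun y : ℝ => 2 / y ^ (1 / 2 : ℝ)) atTop (𝓝 0) := by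
    have := (tendsto_rpow_atTop (by norm_num : (0 : ℝ) < 1 / 2)).inv_tendsto_atTop
    simpa [div_eq_mul_inv] using this.const_mul 2
  have h3 : Tendsto (fun y : ℝ => (Real.sqrt c)⁻¹ *
      (Real.log y / y ^ (1 / 2 : ℝ) + 2 / y ^ (1 / 2 : ℝ))) atTop (𝓝 0) := by
    simpa using (h1.add h2).const_mul (Real.sqrt c)⁻¹
  refine h3.congr' ?_
  filter_upwards [eventually_gt_atTop (0 : ℝ)] with y hy
  have hs : Real.sqrt (c * y) = Real.sqrt c * y ^ (1 / 2 : ℝ) := by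
    rw [Real.sqrt_mul hc.le, Real.sqrt_eq_rpow y]
  rw [hs]
  have hc' : 0 < Real.sqrt c := Real.sqrt_pos.2 hc
  have hy' : 0 < y ^ (1 / 2 : ℝ) := Real.rpow_pos_of_pos hy _
  field_simp

/-- `(log N)^T / N^{1/2} → 0` along the natural numbers. [folklore] -/
private theorem tendsto_log_pow_div_sqrt (T : ℕ) :
    Tendsto (fun N : ℕ => Real.log N ^ T / (N : ℝ) ^ (1 / 2 : ℝ)) atTop (𝓝 0) := by
  have := (isLittleO_log_rpow_rpow_atTop (s := 1 / 2) (T : ℝ) (by norm_num)).tendsto_div_nhds_zero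
  have h := this.comp tendsto_natCast_atTop_atTop
  refine h.congr' ?_
  filter_upwards [eventually_ge_atTop 0] with N hN
  simp only [Function.comp, Real.rpow_natCast]

/-- The number of cubes: `#{(x,h) : cube ⊆ [N]} ≥ (N/(2(k+1)))^{k+1}` for `N ≥ 2(k+1)`.
[cite: GreenTao2010, App. B (B.11)] -/
theorem card_gowersCubeParams_ge (k : ℕ) {N : ℕ} (hN : 2 * (k + 1) ≤ N) :
    ((N : ℝ) / (2 * (k + 1))) ^ (k + 1) ≤ ((gowersCubeParams k N).card : ℝ) := by
  set n₀ : ℕ := N / (k + 1) with hn₀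
  have h1 : (k + 1) * n₀ ≤ N := Nat.mul_div_le N (k + 1)
  have h2 : N < (k + 1) * (n₀ + 1) := Nat.lt_mul_div_succ N (Nat.succ_pos k)
  have hcard : ((n₀ : ℝ)) ^ (k + 1) ≤ ((gowersCubeParams k N).card : ℝ) := by
    exact_mod_cast pow_le_card_gowersCubeParams h1
  have hk0 : (0 : ℝ) < 2 * (k + 1) := by positivity
  have hle : (N : ℝ) / (2 * (k + 1)) ≤ n₀ := by
    rw [div_le_iff₀ hk0]
    have h2' : (N : ℝ) < (k + 1) * ((n₀ : ℝ) + 1) := by exact_mod_cast h2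
    have hN' : (2 : ℝ) * (k + 1) ≤ N := by exact_mod_cast hN
    nlinarith
  calc ((N : ℝ) / (2 * (k + 1))) ^ (k + 1) ≤ (n₀ : ℝ) ^ (k + 1) :=
        pow_le_pow_left₀ (by positivity) hle _
    _ ≤ _ := hcard

set_option maxHeartbeats 400000 in
/-- **Green–Tao (12.6) for every admissible smooth cutoff** (App. D, "The correlation estimate for
`Λ♯`"): for `χ` smooth, supported in `[-1,1]`, with `χ'(0) = 1`, and every `s`, with `R = N^γ`,
`γ = 2^{-(s+3)}`: `‖Λ_{χ;b,W} − 1‖_{U^{s+1}[N]} = o(1)` uniformly in the `W`-trick range and in `b`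
— the tree predicate `GreenTao2010_sharpUniformAt s χ (N ↦ N^γ)`.
[cite: GreenTao2010, §12 (12.6) and App. D, Thm. D.3, p. 1834] -/
theorem sharpUniformAt_of_cutoff {χ : ℝ → ℝ} (hs : ContDiff ℝ (⊤ : ℕ∞) χ)
    (hsupp : ∀ x, 1 ≤ |x| → χ x = 0) (hderiv : deriv χ 0 = 1) (s : ℕ) :
    GreenTao2010_sharpUniformAt s χ fun N => (N : ℝ) ^ (1 / (4 * 2 ^ (s + 1)) : ℝ) := by
  classical
  obtain ⟨K, C, C₀, hK, hC, hC₀, hD⟩ := exists_uniform_d3 hs hsupp (s + 1)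
  have hχ1 : ∀ x, 1 ≤ x → χ x = 0 := fun x hx => hsupp x (hx.trans (le_abs_self x))
  intro ε hε
  -- abbreviations: `k = s+1` variables of `h`, `T = 2^k` vertices, `γ = 1/(4T)`
  set k : ℕ := s + 1 with hk
  set T : ℕ := 2 ^ k with hT
  have hT0 : (0 : ℝ) < (2 : ℝ) ^ k := by positivity
  set γ : ℝ := 1 / (4 * 2 ^ k) with hγ
  have hγ0 : 0 < γ := by positivity
  have hγ1 : γ ≤ 1 := by
    rw [hγ, div_le_one (by positivity)]
    have : (1 : ℝ) ≤ 2 ^ k := one_le_pow₀ (by norm_num)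
    linarith
  have hγT : γ * T = 1 / 4 := by rw [hγ, hT]; push_cast; field_simp
  -- the Gowers-average target and the constants
  set η : ℝ := ε ^ T with hη
  have hη0 : 0 < η := by positivity
  set A₁ : ℝ := 2 ^ T * (4 * ((k : ℝ) + 1)) ^ (k + 1) with hA₁
  set A₂ : ℝ := 2 ^ T * (2 * ((k : ℝ) + 1)) ^ (k + 1) * 3 ^ k with hA₂
  have hA₁0 : 0 < A₁ := by positivity
  have hA₂0 : 0 < A₂ := by positivity
  have hC₀pos : 0 < C₀ := by linarith
  set δ : ℝ := η / (4 * (A₁ * K + 1)) with hδ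
  have hAK : 0 < A₁ * K + 1 := by positivity
  have hδpos : 0 < δ := by positivity
  have hlog1δ : 0 < Real.log (1 + δ) := Real.log_pos (by linarith)
  set w₀ : ℕ := max (2 * T) (⌈4 * 2 ^ T / Real.log (1 + δ)⌉₊ + 1) with hw₀
  -- eventual conditions in `N`
  have hu : Tendsto (fun N : ℕ => (Real.log (Real.log N) + 2) / Real.sqrt (γ * Real.log N))
      atTop (𝓝 0) :=
    (tendsto_log_add_two_div_sqrt hγ0).comp (Real.tendsto_log_atTop.comp tendsto_natCast_atTop_atTop)
  have E1 : ∀ᶠ N : ℕ in atTop, Real.exp (4 * 2 ^ k) ≤ (N : ℝ) :=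
    tendsto_natCast_atTop_atTop.eventually_ge_atTop _
  have E2 : ∀ᶠ N : ℕ in atTop, (Real.log (Real.log N) + 2) / Real.sqrt (γ * Real.log N)
      < min (1 / C₀) δ :=
    (tendsto_order.1 hu).2 _ (lt_min (by positivity) hδpos)
  have E3 : ∀ᶠ N : ℕ in atTop, Real.log N ^ T / (N : ℝ) ^ (1 / 2 : ℝ) < η / (2 * (A₂ * C + 1)) :=
    (tendsto_order.1 (tendsto_log_pow_div_sqrt T)).2 _ (by positivity)
  have E4 : ∀ᶠ N : ℕ in atTop, 2 * (k + 1) ≤ N := eventually_ge_atTop _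
  obtain ⟨N₀, hN₀⟩ := eventually_atTop.1 (E1.and (E2.and (E3.and E4)))
  refine ⟨w₀, N₀, ?_⟩
  intro N hN w hw₀w hwlog b hb1 hbW hcop
  obtain ⟨hE1, hE2, hE3, hE4⟩ := hN₀ N hN
  -- basic facts on `N`
  have h4T : (1 : ℝ) ≤ 4 * 2 ^ k := by
    have : (1 : ℝ) ≤ 2 ^ k := one_le_pow₀ (by norm_num)
    linarith
  have hNpos : (0 : ℝ) < N := lt_of_lt_of_le (Real.exp_pos _) hE1
  have hN1 : 1 ≤ N := by exact_mod_cast (show (0 : ℝ) < N from hNpos)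
  have hlogN : 4 * 2 ^ k ≤ Real.log N := by
    rw [Real.le_log_iff_exp_le hNpos]; exact hE1
  have hlogN1 : 1 ≤ Real.log N := h4T.trans hlogN
  have hllN : 0 ≤ Real.log (Real.log N) := Real.log_nonneg hlogN1
  have hsqrt_pos : 0 < Real.sqrt (γ * Real.log N) := Real.sqrt_pos.2 (by positivity)
  -- the sieve level `R = N^γ`
  set R : ℝ := (N : ℝ) ^ γ with hR
  have hRpos : 0 < R := Real.rpow_pos_of_pos hNpos _
  have hlogR : Real.log R = γ * Real.log N := by rw [hR, Real.log_rpow hNpos]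
  have hRe : Real.exp 1 ≤ R := by
    rw [← Real.log_le_log_iff (Real.exp_pos 1) hRpos, Real.log_exp, hlogR]
    calc (1 : ℝ) = γ * (4 * 2 ^ k) := by rw [hγ]; field_simp
      _ ≤ γ * Real.log N := mul_le_mul_of_nonneg_left hlogN hγ0.le
  have hR1 : 1 < R := lt_of_lt_of_le (by linarith [Real.add_one_le_exp (1 : ℝ)]) hRe
  have hRT : R ^ T = (N : ℝ) ^ (1 / 4 : ℝ) := by
    rw [hR, ← Real.rpow_natCast, ← Real.rpow_mul hNpos.le, hγT]
  have hRTle : R ^ T ≤ N := by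
    rw [hRT]
    calc (N : ℝ) ^ (1 / 4 : ℝ) ≤ (N : ℝ) ^ (1 : ℝ) :=
          Real.rpow_le_rpow_of_exponent_le (by exact_mod_cast hN1) (by norm_num)
      _ = N := Real.rpow_one _
  have hRT2 : R ^ T * R ^ T = (N : ℝ) ^ (1 / 2 : ℝ) := by
    rw [hRT, ← Real.rpow_add hNpos]; norm_num
  -- facts on `w`
  have hw2T : 2 * 2 ^ k ≤ w := le_trans (le_max_left _ _) hw₀w
  have hw1 : 1 ≤ w := le_trans (by linarith [Nat.one_le_two_pow (n := k)] : 1 ≤ 2 * 2 ^ k) hw2T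
  have hwpos : (0 : ℝ) < w := by exact_mod_cast hw1
  have hw_ceil : 4 * 2 ^ T / Real.log (1 + δ) ≤ (w : ℝ) := by
    have h1 : (⌈4 * 2 ^ T / Real.log (1 + δ)⌉₊ : ℝ) + 1 ≤ w := by
      have : ⌈4 * 2 ^ T / Real.log (1 + δ)⌉₊ + 1 ≤ w := le_trans (le_max_right _ _) hw₀w
      exact_mod_cast this
    linarith [Nat.le_ceil (4 * 2 ^ T / Real.log (1 + δ))]
  have hexpw : Real.exp (4 * 2 ^ T / w) - 1 ≤ δ := by
    have h1 : 4 * 2 ^ T / (w : ℝ) ≤ Real.log (1 + δ) := by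
      rw [div_le_iff₀ hwpos]
      have := (div_le_iff₀ hlog1δ).1 hw_ceil
      linarith [mul_comm (w : ℝ) (Real.log (1 + δ))]
    have h2 : Real.exp (4 * 2 ^ T / w) ≤ 1 + δ := by
      calc Real.exp (4 * 2 ^ T / w) ≤ Real.exp (Real.log (1 + δ)) := Real.exp_le_exp.2 h1
        _ = 1 + δ := Real.exp_log (by linarith)
    linarith
  have hlogw : Real.log (w + 1) ≤ w := by
    have := Real.log_le_sub_one_of_pos (by positivity : (0 : ℝ) < w + 1); linarith
  -- `S₁(w) ≤ π(w+1) ≤ w + 1` since `log p / p ≤ 1`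
  have hlS : logSum w ≤ w + 1 := by
    unfold logSum
    calc ∑ p ∈ (w + 1).primesBelow, Real.log p / p ≤ ∑ p ∈ (w + 1).primesBelow, (1 : ℝ) := by
          refine Finset.sum_le_sum fun p hp => ?_
          have hpp : (p : ℕ).Prime := (Nat.mem_primesBelow.1 hp).2
          have hp0 : (0 : ℝ) < p := by exact_mod_cast hpp.pos
          rw [div_le_one hp0]
          linarith [Real.log_le_sub_one_of_pos hp0]
      _ = ((w + 1).primesBelow.card : ℝ) := by simp
      _ ≤ (w + 1 : ℕ) := by
          have : (w + 1).primesBelow.card ≤ w + 1 := by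
            unfold Nat.primesBelow
            exact (Finset.card_filter_le _ _).trans (by simp)
          exact_mod_cast this
      _ = (w : ℝ) + 1 := by push_cast; ring
  have h2w : 2 * (w : ℝ) ≤ Real.log (Real.log N) := by linarith [hwlog]
  -- the side condition of D.3
  have hu_lt : (Real.log (Real.log N) + 2) / Real.sqrt (γ * Real.log N) < 1 / C₀ :=
    lt_of_lt_of_le hE2 (min_le_left _ _)
  have hside : C₀ * (1 + Real.log (w + 1) + logSum w) ≤ Real.sqrt (Real.log R) := by
    rw [hlogR]
    have h1 : C₀ * (1 + Real.log (w + 1) + logSum w) ≤ C₀ * (Real.log (Real.log N) + 2) := by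
      apply mul_le_mul_of_nonneg_left _ hC₀pos.le; linarith
    have h2 : C₀ * (Real.log (Real.log N) + 2) ≤ Real.sqrt (γ * Real.log N) := by
      have h3 := (div_lt_iff₀ hsqrt_pos).1 hu_lt
      have h4 : C₀ * (Real.log (Real.log N) + 2) < C₀ * (1 / C₀ * Real.sqrt (γ * Real.log N)) :=
        mul_lt_mul_of_pos_left h3 hC₀pos
      rw [← mul_assoc, mul_one_div_cancel hC₀pos.ne', one_mul] at h4
      exact h4.le
    exact h1.trans h2
  -- Theorem D.3 for every sub-cube system, normalised: `|G(S) − V| ≤ V K err + E₂`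
  set W : ℕ := primorial w with hW
  have hWpos : 0 < W := primorial_pos w
  set V : ℝ := (volume (cubePolytope k N)).toReal with hV
  have hV0 : 0 ≤ V := ENNReal.toReal_nonneg
  have hVle : V ≤ (2 * (N : ℝ)) ^ (k + 1) := volume_cubePolytope_le k N
  set err : ℝ := (1 + logSum w) / Real.sqrt (Real.log R) + (Real.exp (4 * 2 ^ T / w) - 1) with herr
  set E₂ : ℝ := C * Real.log R ^ T * R ^ T * (R ^ T * ((N : ℝ) + 2 * R ^ T) ^ k) with hE₂
  have hlogR0 : 0 ≤ Real.log R := by rw [hlogR]; positivity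
  have hE₂0 : 0 ≤ E₂ := by
    rw [hE₂]
    have := hRpos.le
    positivity
  have hGS : ∀ S : Finset (Finset (Fin k)),
      |subcubeSum χ R W b N S - V| ≤ V * K * err + E₂ := by
    intro S
    have hmain := hD N hN1 w b hcop hw2T R hRe hside S
    exact abs_subcubeSum_sub_vol_le hχ1 hderiv hR1 W hWpos hb1 N S hE₂0 hmain
  -- the signed sum
  have hsigned := abs_signedSum_le (k := k) (V := V) (B := V * K * err + E₂) hGS
  -- sizes of the two error terms
  have hbr1 : (1 + logSum w) / Real.sqrt (Real.log R) ≤ δ := by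
    have h1 : (1 + logSum w) / Real.sqrt (Real.log R) ≤
        (Real.log (Real.log N) + 2) / Real.sqrt (γ * Real.log N) := by
      rw [hlogR]
      apply div_le_div_of_nonneg_right _ hsqrt_pos.le
      linarith
    exact h1.trans (lt_of_lt_of_le hE2 (min_le_right _ _)).le
  have herr_le : err ≤ 2 * δ := by rw [herr]; linarith
  have herr0 : 0 ≤ err := by
    rw [herr]
    have : 0 ≤ (1 + logSum w) / Real.sqrt (Real.log R) :=
      div_nonneg (by linarith [logSum_nonneg w]) (Real.sqrt_nonneg _)
    have h2 : 0 ≤ Real.exp (4 * 2 ^ T / w) - 1 := by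
      have : (0 : ℝ) ≤ 4 * 2 ^ T / w := by positivity
      linarith [Real.add_one_le_exp (4 * 2 ^ T / (w : ℝ))]
    linarith
  -- the cube count `D = (N/(2(k+1)))^{k+1} ≤ #cubes`
  set D : ℝ := ((N : ℝ) / (2 * (k + 1))) ^ (k + 1) with hDdef
  have hDpos : 0 < D := by positivity
  have hcard : D ≤ ((gowersCubeParams k N).card : ℝ) := card_gowersCubeParams_ge k hE4
  have hcard_pos : (0 : ℝ) < ((gowersCubeParams k N).card : ℝ) := hDpos.trans_le hcard
  have hA₁D : A₁ * D = 2 ^ T * (2 * (N : ℝ)) ^ (k + 1) := by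
    rw [hA₁, hDdef, mul_assoc, ← mul_pow]
    congr 2
    field_simp
    ring
  -- first error term: `2^T · V K err ≤ (η/2) D`
  have hKδ : A₁ * K * (2 * δ) ≤ η / 2 := by
    rw [hδ]
    rw [show A₁ * K * (2 * (η / (4 * (A₁ * K + 1)))) = (η / 2) * (A₁ * K / (A₁ * K + 1)) by
      field_simp; ring]
    have hfrac : A₁ * K / (A₁ * K + 1) ≤ 1 := by rw [div_le_one hAK]; linarith
    calc (η / 2) * (A₁ * K / (A₁ * K + 1)) ≤ (η / 2) * 1 := by gcongr
      _ = η / 2 := mul_one _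
  have hterm1 : 2 ^ T * (V * K * err) ≤ η / 2 * D := by
    calc 2 ^ T * (V * K * err) ≤ 2 ^ T * ((2 * (N : ℝ)) ^ (k + 1) * K * (2 * δ)) := by
          apply mul_le_mul_of_nonneg_left _ (by positivity)
          exact mul_le_mul (mul_le_mul_of_nonneg_right hVle hK) herr_le herr0 (by positivity)
      _ = (A₁ * K * (2 * δ)) * D := by
          rw [show A₁ * K * (2 * δ) * D = (A₁ * D) * (K * (2 * δ)) by ring, hA₁D]; ring
      _ ≤ (η / 2) * D := mul_le_mul_of_nonneg_right hKδ hDpos.le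
  -- second error term: `2^T · E₂ ≤ (η/2) D`
  have hterm2 : 2 ^ T * E₂ ≤ η / 2 * D := by
    have hN2 : 0 < (N : ℝ) ^ (1 / 2 : ℝ) := Real.rpow_pos_of_pos hNpos _
    have hE3' : Real.log N ^ T ≤ η / (2 * (A₂ * C + 1)) * (N : ℝ) ^ (1 / 2 : ℝ) :=
      ((div_lt_iff₀ hN2).1 hE3).le
    have hcube : ((N : ℝ) + 2 * R ^ T) ^ k ≤ (3 * (N : ℝ)) ^ k :=
      pow_le_pow_left₀ (by positivity) (by linarith) k
    have hlogRT : Real.log R ^ T ≤ Real.log N ^ T := by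
      apply pow_le_pow_left₀ hlogR0
      rw [hlogR]
      have : γ * Real.log N ≤ 1 * Real.log N := mul_le_mul_of_nonneg_right hγ1 (by linarith)
      linarith
    -- `E₂ ≤ C (log N)^T N^{1/2} (3N)^k`
    have hE₂le : E₂ ≤ C * Real.log N ^ T * ((N : ℝ) ^ (1 / 2 : ℝ) * (3 * (N : ℝ)) ^ k) := by
      rw [hE₂]
      have e1 : C * Real.log R ^ T * R ^ T * (R ^ T * ((N : ℝ) + 2 * R ^ T) ^ k) =
          C * Real.log R ^ T * ((R ^ T * R ^ T) * ((N : ℝ) + 2 * R ^ T) ^ k) := by ring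
      rw [e1, hRT2]
      apply mul_le_mul (mul_le_mul_of_nonneg_left hlogRT hC) _ (by positivity) (by positivity)
      exact mul_le_mul_of_nonneg_left hcube hN2.le
    -- `D · η/2` versus `N^{k+1}`
    have hDN : (2 * ((k : ℝ) + 1)) ^ (k + 1) * D = (N : ℝ) ^ (k + 1) := by
      rw [hDdef, ← mul_pow]
      congr 1
      field_simp
    have hsplit : (N : ℝ) ^ (k + 1) = (N : ℝ) ^ (1 / 2 : ℝ) * ((N : ℝ) ^ (1 / 2 : ℝ) * (N : ℝ) ^ k) := by
      rw [← mul_assoc, ← Real.rpow_add hNpos, show (1 / 2 : ℝ) + 1 / 2 = 1 by norm_num,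
        Real.rpow_one, pow_succ]
      ring
    have hA₂' : 2 ^ T * (C * Real.log N ^ T * ((N : ℝ) ^ (1 / 2 : ℝ) * (3 * (N : ℝ)) ^ k)) =
        (A₂ * C * Real.log N ^ T * ((N : ℝ) ^ (1 / 2 : ℝ) * (N : ℝ) ^ k)) /
          (2 * ((k : ℝ) + 1)) ^ (k + 1) := by
      rw [hA₂, mul_pow]
      field_simp
    have hkpos : (0 : ℝ) < (2 * ((k : ℝ) + 1)) ^ (k + 1) := by positivity
    calc 2 ^ T * E₂ ≤ 2 ^ T * (C * Real.log N ^ T * ((N : ℝ) ^ (1 / 2 : ℝ) * (3 * (N : ℝ)) ^ k)) :=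
          mul_le_mul_of_nonneg_left hE₂le (by positivity)
      _ = (A₂ * C * Real.log N ^ T * ((N : ℝ) ^ (1 / 2 : ℝ) * (N : ℝ) ^ k)) /
            (2 * ((k : ℝ) + 1)) ^ (k + 1) := hA₂'
      _ ≤ ((η / 2) * (N : ℝ) ^ (k + 1)) / (2 * ((k : ℝ) + 1)) ^ (k + 1) := by
          apply div_le_div_of_nonneg_right _ hkpos.le
          rw [hsplit]
          have h1 : A₂ * C * Real.log N ^ T ≤ (η / 2) * (N : ℝ) ^ (1 / 2 : ℝ) := by
            calc A₂ * C * Real.log N ^ T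
                ≤ A₂ * C * (η / (2 * (A₂ * C + 1)) * (N : ℝ) ^ (1 / 2 : ℝ)) :=
                  mul_le_mul_of_nonneg_left hE3' (by positivity)
              _ = (η / 2) * (N : ℝ) ^ (1 / 2 : ℝ) * (A₂ * C / (A₂ * C + 1)) := by
                  field_simp
              _ ≤ (η / 2) * (N : ℝ) ^ (1 / 2 : ℝ) * 1 := by
                  have hA : 0 < A₂ * C + 1 := by positivity
                  have hfrac : A₂ * C / (A₂ * C + 1) ≤ 1 := by rw [div_le_one hA]; linarith
                  gcongr
              _ = (η / 2) * (N : ℝ) ^ (1 / 2 : ℝ) := mul_one _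
          calc A₂ * C * Real.log N ^ T * ((N : ℝ) ^ (1 / 2 : ℝ) * (N : ℝ) ^ k)
              ≤ ((η / 2) * (N : ℝ) ^ (1 / 2 : ℝ)) * ((N : ℝ) ^ (1 / 2 : ℝ) * (N : ℝ) ^ k) :=
                mul_le_mul_of_nonneg_right h1 (by positivity)
            _ = η / 2 * ((N : ℝ) ^ (1 / 2 : ℝ) * ((N : ℝ) ^ (1 / 2 : ℝ) * (N : ℝ) ^ k)) := by ring
      _ = η / 2 * D := by rw [← hDN]; field_simp
  -- the Gowers average
  set F : ℤ → ℝ := fun n => vonMangoldtSmoothW χ R W b n.toNat with hF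
  have hsum : ∑ p ∈ gowersCubeParams k N, gowersCubeTerm k (fun n => ((F n - 1 : ℝ) : ℂ)) p.1 p.2 =
      ((∑ S ∈ (Finset.univ : Finset (Finset (Fin k))).powerset, (-1 : ℝ) ^ (2 ^ k - S.card) *
          subcubeSum χ R W b N S : ℝ) : ℂ) := by
    rw [sum_gowersCubeTerm_sub_one_eq]
    rfl
  have habsS : |∑ S ∈ (Finset.univ : Finset (Finset (Fin k))).powerset, (-1 : ℝ) ^ (2 ^ k - S.card) *
      subcubeSum χ R W b N S| ≤ η * D := by
    calc _ ≤ 2 ^ (2 ^ k) * (V * K * err + E₂) := hsigned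
      _ = 2 ^ T * (V * K * err) + 2 ^ T * E₂ := by rw [hT]; ring
      _ ≤ η / 2 * D + η / 2 * D := add_le_add hterm1 hterm2
      _ = η * D := by ring
  have havg : ‖uniformityAvg k N (fun n => ((F n - 1 : ℝ) : ℂ))‖ ≤ η := by
    unfold uniformityAvg
    rw [hsum, norm_div, Complex.norm_real, Complex.norm_natCast, Real.norm_eq_abs,
      div_le_iff₀ hcard_pos]
    exact habsS.trans (mul_le_mul_of_nonneg_left hcard hη0.le)
  -- `‖·‖_{U^k[N]} = ‖avg‖^{1/2^k} ≤ ε`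
  have hfin : uniformityNorm k N (fun n => ((F n - 1 : ℝ) : ℂ)) ≤ ε := by
    unfold uniformityNorm
    have hexp : ((2 : ℝ) ^ k)⁻¹ = ((T : ℕ) : ℝ)⁻¹ := by rw [hT]; push_cast; rfl
    rw [hexp]
    have hTne : T ≠ 0 := by rw [hT]; positivity
    calc ‖uniformityAvg k N (fun n => ((F n - 1 : ℝ) : ℂ))‖ ^ (((T : ℕ) : ℝ)⁻¹)
        ≤ η ^ (((T : ℕ) : ℝ)⁻¹) := Real.rpow_le_rpow (norm_nonneg _) havg (by positivity)
      _ = ε := by rw [hη]; exact Real.pow_rpow_inv_natCast hε.le hTne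
  simpa [hF] using hfin

end SharpGY

/-! ## The discharge -/

/-- **`GreenTao2010_sharpGoldstonYildirim` holds** (Green–Tao 2010, display (12.6), for every level
`s ≥ 1` — in fact for every `s`): with the cutoff of `SharpGY.exists_sharpCutoff` and
`γ = 2^{-(s+3)}`, the `W`-tricked smooth piece `Λ♯_{b,W}` is Gowers-uniform, by Thm. D.3 with
`a_i = 1` (`SharpGY.sharpUniformAt_of_cutoff`). [cite: GreenTao2010, §12 (12.6) and App. D, p. 1834] -/
theorem GreenTao2010_sharpGoldstonYildirim_holds : GreenTao2010_sharpGoldstonYildirim := by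
  intro s _
  obtain ⟨χ, Lχ, h0, hLip, hL, hs, hsupp, hderiv⟩ := SharpGY.exists_sharpCutoff
  exact ⟨χ, Lχ, 1 / (4 * 2 ^ (s + 1)), h0, hLip, hL, by positivity,
    SharpGY.sharpUniformAt_of_cutoff hs hsupp hderiv s⟩

end Literature.NumberTheory.Sieve

end
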